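import Literature.NumberTheory.EllipticCurves.HeegnerPointsKolyvaginPairing
import HarnessLib

/-!
# The pairing `[s, ρ]` when `Γ_K` acts on `E[n]` through commuting operators (CM at `p = 2`)

Sibling of `HeegnerPointsKolyvaginPairing` (Gross 1991, §9, Props. 9.1 and 9.3; McCallum 1991,
§3 (2)), whose two algebraic inputs are stated for the non-CM situation at an odd prime: Prop. 9.1
(`eq_zero_of_h1Eval_eq_zero`) asks for an element acting as the homothety `-1` with `2`
invertible on `E[n]`, and Prop. 9.3 (`KolyvaginPairing.eq_top_of_stable_of_indep`,
`exists_h1Eval_eq`) for a simple `Γ_K`-module `E[p]` whose commutant consists of the INTEGER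
scalars. Neither holds for `n = 2` on a curve with complex multiplication by `ℤ[ω]` over a field
`K ∋ ω`: there `E[2] ≅ 𝔽₄`, `Γ_K` acts through the scalar group `𝔽₄ˣ` (so by pairwise commuting
operators, with `ω - 1 = ω²` invertible but `2 = 0`), and the commutant of the (still simple)
`Γ_K`-module `E[2]` is `𝔽₄ = {a + bω}`, not `𝔽₂`. This file proves the replacements, for any
field `K`, any Weierstrass curve and any level `n` (everything is **proved**; no named fact):

* `eq_zero_of_h1Eval_eq_zero_of_comm` — **Prop. 9.1, commuting form**: if `Γ_K` acts on `E[n]`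
  through pairwise commuting operators and some `z ∈ Γ_K` has `z - 1` invertible on `E[n]`
  (an inverse `ι` commuting with the action is part of the data), then a class `x ∈ H¹(K, E[n])`
  with `[x, ρ] = 0` for all `ρ ∈ Γ_{K(E[n])}` vanishes — i.e. `Res : H¹(K, E[n]) →
  Hom(Γ_{K(E[n])}, E[n])` is injective (memo MEMO-bsd-cm-two §57.4 Step 1: `H¹(𝒢, X[2]) = 0`
  for `𝒢 ≅ μ₃`). Cocycle proof as in the tree's Prop. 9.1 with `ι = (z-1)⁻¹` in place of `½`:
  `zg = gz·n₀`, `n₀ ∈ Γ_{K(E[n])}`, gives `(z-1)f(g) = (g-1)f(z)`, so `f = ∂(ι f(z))`.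
* `KolyvaginPairing.eq_top_of_stable_of_indep_of_comm` — **Prop. 9.3 in abstract form with an
  enlarged commutant**: `T` a simple `G`-module whose `G`-equivariant endomorphisms are all of
  the form `t ↦ a•t + b•w t` for a fixed additive `w : T → T`; then a `G`-stable `M ≤ T^r` whose
  coordinate functionals admit no relation `∑ (a_i m_i + b_i w(m_i)) = 0` on `M` other than
  `a_i ≡ b_i ≡ 0 (mod p)` is all of `T^r` (same induction on `r` as the tree's).
* `exists_h1Eval_eq_of_comm` — **Prop. 9.3 / McCallum (2), commuting form**: under the
  hypotheses of both items and for an additive operator `wH` on `H¹(K, E[n])` lying over `w`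
  (`[wH x, ρ] = w [x, ρ]` on `Γ_{K(E[n])}`), classes `x₁, …, x_r` independent over `(ℤ/p)[w]`
  (`∑ (a_i x_i + b_i wH x_i) = 0 ⟹ p ∣ a_i, p ∣ b_i`) have jointly surjective evaluations: every
  `(e_i) ∈ E[n]^r` is `([x_i, ρ])_i` for some `ρ ∈ Γ_{K(E[n])}` (memo Step 2:
  `Gal(L_{X,S}/L_X) ≅ Hom_{𝔽₄}(S, X[2])`).

These are the inputs a `p = 2`, CM counterpart of the tree's `exists_kolyvaginPrime_gt`
(`HeegnerPointsKolyvaginCebotarevProofs`: McCallum's Cor. 3.2 from the Čebotarev density theorem)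
needs in place of `KolyvaginImage.*` / Prop. 9.1 (leaf (L3) of
`Summits/…/SylvesterTwoHeegnerIndexCoupledDescentAtTwo.lean`). Not here: the `τ`-semilinear
realizability algebra (memo Steps 3–4), the two-curve disjointness, and the density argument.

## References

* B. H. Gross, *Kolyvagin's work on modular elliptic curves*, LMS Lecture Note Ser. 153 (1991),
  §9, Props. 9.1 and 9.3 (held: `book:editornd-l-functions-arithmetic`, PDF pp. 227–228).
  [GrossLMS1991]
* W. G. McCallum, *Kolyvagin's work on Shafarevich–Tate groups*, ibid., §3 (2). [McCallumLMS1991]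
* Cell memo MEMO-bsd-cm-two §57.4, Steps 1–2 (the `p = 2`, `ℤ[ω]`-CM dictionary).
-/

noncomputable section

open scoped Classical
open WeierstrassCurve
open Literature.NumberTheory.GaloisRepresentations

universe u

namespace Literature.NumberTheory.EllipticCurves
namespace KolyvaginPairing

variable {G : Type*} [Group G] {T : Type*} [AddCommGroup T] [DistribMulAction G T]

/-- **Gross 1991, Prop. 9.3 in abstract form, with commutant `{a + b w}`.** Let `G` act on `T`
so that `T` is a simple `G`-module (`hS`) and every `G`-equivariant additive endomorphism of `T`
is `t ↦ a•t + b•w t` for some integers `a, b` (`hC`; `w : T → T` a fixed additive map — for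
`T = E[2] ≅ 𝔽₄` with `G` acting through `𝔽₄ˣ`, `w = [ω]` and the commutant is `𝔽₄`). Let `p` be
a prime. A `G`-stable subgroup `M ≤ T^r` whose coordinate functionals satisfy no relation
`∑ (a_i m_i + b_i w(m_i)) = 0` on `M` except with all `a_i, b_i ≡ 0 (mod p)` is all of `T^r`.
Proof: the tree's induction on `r` (`eq_top_of_stable_of_indep`) verbatim — the projection to
`T^r` is onto by induction, its fibre over `0` is `⊥` or `⊤` by simplicity, and `⊥` would make the
last coordinate a `G`-linear, hence `{a + bw}`-valued, combination of the others on `M`, a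
forbidden relation with coefficient `(-1, 0)` on the last coordinate. (Variant of Gross's
Prop. 9.3 argument with an enlarged commutant; the printed case is `w = 0`.)
[cite: GrossLMS1991, Prop. 9.3 (proof)] -/
theorem eq_top_of_stable_of_indep_of_comm {p : ℕ} (hp : p.Prime) (w : T →+ T)
    (hS : ∀ H : AddSubgroup T, (∀ g : G, ∀ t ∈ H, g • t ∈ H) → H = ⊥ ∨ H = ⊤)
    (hC : ∀ f : T →+ T, (∀ (g : G) (t : T), f (g • t) = g • f t) →
      ∃ a b : ℤ, ∀ t, f t = a • t + b • w t) :
    ∀ (r : ℕ) (M : AddSubgroup (Fin r → T)), (∀ g : G, ∀ m ∈ M, g • m ∈ M) →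
      (∀ a b : Fin r → ℤ, (∀ m ∈ M, ∑ i, (a i • m i + b i • w (m i)) = 0) →
        ∀ i, (p : ℤ) ∣ a i ∧ (p : ℤ) ∣ b i) → M = ⊤ := by
  intro r
  induction r with
  | zero =>
    intro M _ _
    exact eq_top_iff.mpr fun m _ ↦ by rw [Subsingleton.elim m 0]; exact zero_mem M
  | succ r ih =>
    intro M hstab hind
    -- the projection `M'` of `M` to the first `r` coordinates is everything
    set M' := M.map (initHom T r) with hM'
    have hM'top : M' = ⊤ := by
      refine ih M' (fun g m' hm' ↦ ?_) (fun a b hab i ↦ ?_)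
      · obtain ⟨m, hm, rfl⟩ := hm'
        exact ⟨g • m, hstab g m hm, rfl⟩
      · have h := hind (Fin.snoc a 0) (Fin.snoc b 0) (fun m hm ↦ ?_) (Fin.castSucc i)
        · simpa using h
        · rw [Fin.sum_univ_castSucc]
          simp only [Fin.snoc_castSucc, Fin.snoc_last, zero_smul, add_zero]
          have := hab (initHom T r m) ⟨m, hm, rfl⟩
          simpa using this
    have hsurj : ∀ y : Fin r → T, ∃ m ∈ M, initHom T r m = y := fun y ↦ by
      have hy : y ∈ M' := by rw [hM'top]; trivial
      obtain ⟨m, hm, hmy⟩ := hy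
      exact ⟨m, hm, hmy⟩
    -- the fibre `N` of `M` over `0`
    set N : AddSubgroup T := M.comap (AddMonoidHom.single (fun _ : Fin (r + 1) ↦ T) (Fin.last r))
      with hN
    have hNmem : ∀ t, t ∈ N ↔ (Pi.single (Fin.last r) t : Fin (r + 1) → T) ∈ M := fun t ↦ Iff.rfl
    have hNstab : ∀ g : G, ∀ t ∈ N, g • t ∈ N := fun g t ht ↦ by
      rw [hNmem] at ht ⊢
      rw [← smul_single_last]
      exact hstab g _ ht
    rcases hS N hNstab with hbot | htop
    · -- `N = ⊥`: the last coordinate is a `G`-linear function of the others: contradiction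
      exfalso
      have hlast : ∀ m ∈ M, ∀ m₁ ∈ M, initHom T r m₁ = initHom T r m →
          m (Fin.last r) = m₁ (Fin.last r) := by
        intro m hm m₁ hm₁ h
        have hd : m - m₁ ∈ M := M.sub_mem hm hm₁
        have h0 : initHom T r (m - m₁) = 0 := by rw [map_sub, h, sub_self]
        rw [eq_single_of_initHom_eq_zero h0] at hd
        have : (m - m₁) (Fin.last r) ∈ N := (hNmem _).mpr hd
        rw [hbot, AddSubgroup.mem_bot, Pi.sub_apply, sub_eq_zero] at this
        exact this
      -- the function `F y = (lift of y) (last)`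
      set F : (Fin r → T) → T := fun y ↦ (Classical.choose (hsurj y)) (Fin.last r) with hF
      have hFspec : ∀ m ∈ M, F (initHom T r m) = m (Fin.last r) := fun m hm ↦ by
        obtain ⟨hm₁, h₁⟩ := Classical.choose_spec (hsurj (initHom T r m))
        exact (hlast m hm _ hm₁ h₁).symm
      have hFadd : ∀ y y', F (y + y') = F y + F y' := fun y y' ↦ by
        obtain ⟨m, hm, rfl⟩ := hsurj y
        obtain ⟨m', hm', rfl⟩ := hsurj y'
        rw [← map_add, hFspec _ (M.add_mem hm hm'), hFspec _ hm, hFspec _ hm', Pi.add_apply]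
      have hFsmul : ∀ (g : G) y, F (g • y) = g • F y := fun g y ↦ by
        obtain ⟨m, hm, rfl⟩ := hsurj y
        have : g • initHom T r m = initHom T r (g • m) := rfl
        rw [this, hFspec _ (hstab g m hm), hFspec _ hm, Pi.smul_apply]
      let Fh : (Fin r → T) →+ T :=
        { toFun := F, map_zero' := by simpa using hFadd 0 0, map_add' := hFadd }
      have hk : ∀ i : Fin r, ∃ a b : ℤ, ∀ t, F (Pi.single i t) = a • t + b • w t := fun i ↦
        hC (Fh.comp (AddMonoidHom.single (fun _ : Fin r ↦ T) i)) fun g t ↦ by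
          change F (Pi.single i (g • t)) = g • F (Pi.single i t)
          rw [← smul_single, hFsmul]
      choose ka kb hk using hk
      refine hp.one_lt.ne' (Nat.dvd_one.mp ?_)
      have h := hind (Fin.snoc ka (-1)) (Fin.snoc kb 0) (fun m hm ↦ ?_) (Fin.last r)
      · rw [Fin.snoc_last] at h
        exact_mod_cast dvd_neg.mp h.1
      · rw [Fin.sum_univ_castSucc]
        simp only [Fin.snoc_castSucc, Fin.snoc_last, neg_smul, one_smul, zero_smul, add_zero]
        have hm' : m (Fin.last r) = ∑ i : Fin r, (ka i • m i.castSucc + kb i • w (m i.castSucc)) := by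
          rw [← hFspec m hm]
          conv_lhs => rw [show initHom T r m = ∑ i : Fin r, Pi.single i (m i.castSucc) from
            (Finset.univ_sum_single _).symm]
          change Fh (∑ i : Fin r, Pi.single i (m i.castSucc)) = _
          rw [map_sum Fh]
          exact Finset.sum_congr rfl fun i _ ↦ hk i _
        rw [hm', add_neg_eq_zero]
    · -- `N = ⊤`: `M` contains the last coordinate axis and surjects onto the rest
      refine eq_top_iff.mpr fun m₀ _ ↦ ?_
      obtain ⟨m, hm, h⟩ := hsurj (initHom T r m₀)
      rw [eq_add_single_of_initHom_eq h]
      refine M.add_mem hm ((hNmem _).mp ?_)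
      rw [htop]; trivial

end KolyvaginPairing

/-! ## Prop. 9.1 and Prop. 9.3 for `H¹(K, E[n])` when `Γ_K` acts through commuting operators -/

section Comm

variable {K : Type u} [Field K] (W : WeierstrassCurve K) (n : ℤ)

/-- **Gross 1991, Prop. 9.1 — commuting form (injectivity of restriction).** Suppose `Γ_K` acts
on `E[n]` through pairwise commuting operators (`hcomm`; e.g. through an abelian quotient, as for
a CM curve over a field containing the CM field, or whenever the image is a group of scalars),
and some `z ∈ Γ_K` has `z - 1` invertible on `E[n]`: an additive `ι` with `ι (z•P - P) = P`,
commuting with the action (`hιg`). Then a class `x ∈ H¹(K, E[n])` with `[x, ρ] = 0` for every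
`ρ ∈ Γ_{K(E[n])}` is zero. (At `n = 2` for `y² = x³ + b` over `K ∋ ω`, `∛b ∉ K`: `z` acting as
`ω` on `E[2] ≅ 𝔽₄`, `z - 1 = ω²`, `ι = z` itself — memo two §57.4 Step 1, `H¹(μ₃, 𝔽₄) = 0`.)
Proof on cocycles: `zg = gz·n₀` with `n₀ = z⁻¹g⁻¹zg ∈ Γ_{K(E[n])}` by commutativity, so
`f(z) + z f(g) = f(zg) = f(gz n₀) = f(g) + g f(z)`, i.e. `(z-1) f(g) = (g-1) f(z)` and
`f = ∂(ι f(z))`. [cite: GrossLMS1991, Prop. 9.1] -/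
theorem eq_zero_of_h1Eval_eq_zero_of_comm
    (hcomm : ∀ (g h : (Field.absoluteGaloisGroup K)) (P : geomTorsion W n),
      g • h • P = h • g • P)
    {z : (Field.absoluteGaloisGroup K)} (ι : geomTorsion W n →+ geomTorsion W n)
    (hι : ∀ P : geomTorsion W n, ι (z • P - P) = P)
    (hιg : ∀ (g : (Field.absoluteGaloisGroup K)) (P : geomTorsion W n),
      ι (g • P) = g • ι P)
    {x : galH1Torsion W n} (hx : ∀ ρ ∈ torsionFixing W n, h1Eval W n x ρ = 0) : x = 0 := by
  rw [← oneCocycleClass_reprCocycle W n x]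
  set φ := reprCocycle W n x with hφ
  refine (oneCocycleClass_eq_zero_iff _ φ).mpr ⟨ι (φ.1 z), fun g ↦ ?_⟩
  -- `n₀ = z⁻¹ g⁻¹ z g` acts trivially on `E[n]`
  have hn₀ : z⁻¹ * g⁻¹ * z * g ∈ torsionFixing W n := by
    refine (mem_torsionFixing_iff W n).mpr fun P ↦ ?_
    rw [mul_smul, mul_smul, mul_smul, hcomm z g P, ← mul_smul g⁻¹, inv_mul_cancel, one_smul,
      inv_smul_smul]
  have hzg : z * g = g * z * (z⁻¹ * g⁻¹ * z * g) := by group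
  have h1 := φ.2 z g
  have h2 := φ.2 (g * z) (z⁻¹ * g⁻¹ * z * g)
  have h3 := φ.2 g z
  rw [discreteTopRep_ρ_apply] at h1 h2 h3
  have h4 : φ.1 (z⁻¹ * g⁻¹ * z * g) = 0 := hx _ hn₀
  rw [← hzg, h1, h4, smul_zero, add_zero, h3] at h2
  -- `h2 : φ z + z • φ g = φ g + g • φ z`, i.e. `z • φ g - φ g = g • φ z - φ z`
  have key : z • φ.1 g - φ.1 g = g • φ.1 z - φ.1 z := by
    rw [← sub_eq_zero]
    have e : z • φ.1 g - φ.1 g - (g • φ.1 z - φ.1 z) =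
        φ.1 z + z • φ.1 g - (φ.1 g + g • φ.1 z) := by abel
    rw [e, h2, sub_self]
  rw [discreteTopRep_ρ_apply, ← hιg, ← map_sub, ← key, hι]

end Comm

section CommSurjective

variable {K : Type u} [Field K] (W : WeierstrassCurve K) {p : ℕ}

/-- **Gross 1991, Prop. 9.3 / McCallum 1991, (2) — commuting form: the evaluations at classes
independent over `(ℤ/p)[w]` are jointly surjective.** Hypotheses: `E[n]` is a simple
`Γ_K`-module (`hS`) whose `Γ_K`-equivariant endomorphisms are all `P ↦ a•P + b•w P` for a fixed
additive `w` on `E[n]` (`hC`); `Γ_K` acts through commuting operators with some `z - 1`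
invertible (`hcomm`, `ι`, as in `eq_zero_of_h1Eval_eq_zero_of_comm`); `wH` is an additive
operator on `H¹(K, E[n])` lying over `w` (`hwH : [wH x, ρ] = w [x, ρ]` for `ρ ∈ Γ_{K(E[n])}` —
the operator induced by `w` on cocycles); and `x₁, …, x_r ∈ H¹(K, E[n])` admit no relation
`∑ (a_i x_i + b_i wH x_i) = 0` except with `p ∣ a_i`, `p ∣ b_i`. Then for every
`(e_i) ∈ E[n]^r` there is `ρ ∈ Γ_{K(E[n])}` with `[x_i, ρ] = e_i` for all `i`. (At `p = n = 2`,
CM by `ℤ[ω]`, `K ∋ ω`: `Gal(L_{X,S}/L_X) ≅ Hom_{𝔽₄}(S, X[2])` — memo two §57.4 Step 2.) Proof: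
`KolyvaginPairing.eq_top_of_stable_of_indep_of_comm` for the `Γ_K`-stable subgroup `jointRange`,
its functionals being independent by `eq_zero_of_h1Eval_eq_zero_of_comm` applied to
`∑ (a_i x_i + b_i wH x_i)`. [cite: GrossLMS1991, Prop. 9.3] -/
theorem exists_h1Eval_eq_of_comm (hp : p.Prime)
    (hS : ∀ H : AddSubgroup (geomTorsion W p),
      (∀ g : (Field.absoluteGaloisGroup K), ∀ t ∈ H, g • t ∈ H) → H = ⊥ ∨ H = ⊤)
    (w : geomTorsion W p →+ geomTorsion W p)
    (hC : ∀ f : geomTorsion W p →+ geomTorsion W p,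
      (∀ (g : (Field.absoluteGaloisGroup K)) (t : geomTorsion W p), f (g • t) = g • f t) →
        ∃ a b : ℤ, ∀ t, f t = a • t + b • w t)
    (hcomm : ∀ (g h : (Field.absoluteGaloisGroup K)) (P : geomTorsion W p),
      g • h • P = h • g • P)
    {z : (Field.absoluteGaloisGroup K)} (ι : geomTorsion W p →+ geomTorsion W p)
    (hι : ∀ P : geomTorsion W p, ι (z • P - P) = P)
    (hιg : ∀ (g : (Field.absoluteGaloisGroup K)) (P : geomTorsion W p),
      ι (g • P) = g • ι P)
    (wH : galH1Torsion W p →+ galH1Torsion W p)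
    (hwH : ∀ (x : galH1Torsion W p), ∀ ρ ∈ torsionFixing W p,
      h1Eval W p (wH x) ρ = w (h1Eval W p x ρ))
    {r : ℕ} (xs : Fin r → galH1Torsion W p)
    (hind : ∀ a b : Fin r → ℤ, ∑ i, (a i • xs i + b i • wH (xs i)) = 0 →
      ∀ i, (p : ℤ) ∣ a i ∧ (p : ℤ) ∣ b i)
    (e : Fin r → geomTorsion W p) :
    ∃ ρ ∈ torsionFixing W p, ∀ i, h1Eval W p (xs i) ρ = e i := by
  have htop := KolyvaginPairing.eq_top_of_stable_of_indep_of_comm hp w hS hC r (jointRange W xs)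
    (fun g m hm ↦ smul_mem_jointRange W xs g hm) (fun a b hab i ↦ ?_)
  · have : e ∈ jointRange W xs := by rw [htop]; trivial
    exact this
  · refine hind a b (eq_zero_of_h1Eval_eq_zero_of_comm W p hcomm ι hι hιg fun ρ hρ ↦ ?_) i
    rw [h1Eval_sum W p _ _ hρ]
    simp only [h1Eval_add W p _ _ hρ, h1Eval_zsmul W p _ _ hρ, hwH _ _ hρ]
    exact hab _ ⟨ρ, hρ, fun i ↦ rfl⟩

end CommSurjective

end Literature.NumberTheory.EllipticCurves

end
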